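import Summits.HodgeConjecture.HodgeCM.PerL34.ArchCOrbitSmoke_1

/-! PORT of `HodgeCM/PerL34/ArchCOrbitSmoke.lean` (HodgeCMPerL run 82) — part 2: continuation of `Summits.HodgeConjecture.HodgeCM.PerL34.ArchCOrbitSmoke_1` (split at a top-level declaration boundary by port_pkg.py; scope re-opened below; declarations unchanged). -/

-- port_pkg: scope re-opened for this part (file-level context, then the namespace/section stack open at the cut)
set_option autoImplicit false
noncomputable section
open scoped Topology
open Filter
namespace HodgeCM
namespace PerL34
namespace ArchC
namespace OrbitSmoke
open HodgeCM.Prior.Perl34File HodgeCM.Prior.Perl34File.Perl34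
local notation "⟪" x ", " y "⟫" => @inner ℂ _ _ x y
namespace CircleToy
open AnalyticSmoke.Line (places ell ell_φ₀ ell_ωT χ_eq_one φ₀_ne_zero)
/-- **`FockSmoothBridge` over the circle toy with a GENUINE one-parameter group.**  Fock layer = pv12-g3's line
(`φ⁰ = 1`, empty ladder family, trivial torus, `ιT = 1`, `w = 1`), `ins f := ℓ` (the product functional); real
direction `X = i·id`; curve `e(s) = exp(is) ∈ Circle`; `smooth` PROVED with limit `ℓ(iφ) = i·ℓφ`
(`tendsto_slope_coe_exp_mul`); `invariance` is the non-trivial `CircleToy.invariance`.  Every field PROVED. -/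
def smoothBridge : FockSmoothBridge core torus pointed where
  pl := places
  ιT := 1
  w := 1
  w_norm := fun t => by rw [MonoidHom.one_apply, norm_one]
  w_loc := fun t => by rw [MonoidHom.one_apply, inv_one]; exact χ_eq_one t
  TΦc_add := fun Φ Ψ => add_smul Φ Ψ (ContinuousLinearMap.id ℂ ℂ)
  TΦc_smul := fun c Φ => mul_smul c Φ (ContinuousLinearMap.id ℂ ℂ)
  cont := fun p v => by
    show Continuous fun Φ : ℂ => Φ * v
    exact continuous_id.mul continuous_const
  FinIdx := Unit
  ins := fun _ => ell
  dense := by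
    have hmem : ell places.φ₀ ∈ Submodule.span ℂ (Set.range fun q : Unit × places.F => (fun _ : Unit => ell) q.1 q.2) :=
      Submodule.subset_span ⟨((), places.φ₀), rfl⟩
    have htop : Submodule.span ℂ (Set.range fun q : Unit × places.F => (fun _ : Unit => ell) q.1 q.2) = ⊤ := by
      rw [Submodule.eq_top_iff']
      intro z
      have hz := Submodule.smul_mem _ z hmem
      rwa [ell_φ₀, smul_eq_mul, mul_one] at hz
    rw [htop, Submodule.top_coe]
    exact dense_univ
  omg_ins := fun _ t φ => by
    show ((1 : Circle) : ℂ) * ell φ = ell (places.ωT t φ)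
    rw [Circle.coe_one, one_mul, ell_ωT]
  invariance := invariance
  ιR := Unit
  XR := fun _ => Complex.I • LinearMap.id
  e := fun _ s => Circle.exp s
  ladder_span := fun k => (k.2 : Empty).elim
  smooth := fun _ _ φ => by
    show Tendsto (fun s : ℝ => ((s : ℝ) : ℂ)⁻¹ • ((Circle.exp s : ℂ) * ell φ - (Circle.exp 0 : ℂ) * ell φ))
      (𝓝[≠] 0) (𝓝 (ell ((Complex.I • (LinearMap.id : places.F →ₗ[ℂ] places.F)) φ)))
    rw [LinearMap.smul_apply, LinearMap.id_apply, map_smul, smul_eq_mul]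
    exact tendsto_slope_coe_exp_mul (ell φ)
  wOccurs_of_eigenvector := fun _ _ => trivial

/-- (Ported verbatim from the HodgeCMPerL package; no docstring in the source.) -/
theorem nonempty_smoothBridge : Nonempty (FockSmoothBridge core torus pointed) := ⟨smoothBridge⟩

/-- (Ported verbatim from the HodgeCMPerL package; no docstring in the source.) -/
theorem nonempty_scalarBridge : Nonempty (FockScalarBridge core torus pointed) := ⟨smoothBridge.toScalarBridge⟩

/-- (Ported verbatim from the HodgeCMPerL package; no docstring in the source.) -/
theorem nonempty_orbitCore : Nonempty (OrbitCore core pointed) := ⟨smoothBridge.toOrbitCore⟩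

/-- **The real direction is NON-ZERO on φ⁰** (X φ⁰ = iφ⁰). -/
theorem XR_φ₀_ne_zero : smoothBridge.XR () places.φ₀ ≠ 0 := by
  show (Complex.I • (LinearMap.id : places.F →ₗ[ℂ] places.F)) places.φ₀ ≠ 0
  rw [LinearMap.smul_apply, LinearMap.id_apply]
  exact smul_ne_zero Complex.I_ne_zero φ₀_ne_zero

/-- **The limit of the [D5′] clause is NON-ZERO**: (Xφ⁰) ⊗ Φ_f = i ≠ 0 in 𝒮 = ℂ. -/
theorem smooth_limit_eq_I : smoothBridge.ins () (smoothBridge.XR () places.φ₀) = Complex.I := by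
  show ell ((Complex.I • (LinearMap.id : places.F →ₗ[ℂ] places.F)) places.φ₀) = Complex.I
  rw [LinearMap.smul_apply, LinearMap.id_apply, map_smul, ell_φ₀, smul_eq_mul, mul_one]

/-- (Ported verbatim from the HodgeCMPerL package; no docstring in the source.) -/
theorem smooth_limit_ne_zero : smoothBridge.ins () (smoothBridge.XR () places.φ₀) ≠ 0 := by
  rw [smooth_limit_eq_I]; exact Complex.I_ne_zero

/-- **The derived scalar derivative `hFpt` (KERNEL, `FockSmoothBridge.toScalarBridge`) has the NON-ZERO value i** at
(φ⁰, g = the point, v = 1): d/ds|₀ 𝒯_{ω(e(s))(φ⁰⊗Φ_f)}(1)(g) = i. -/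
theorem hFpt_value_ne_zero :
    HasDerivAt (fun s : ℝ => pointed.evalPt () (core.TΦc (core.omg (smoothBridge.e () s) (smoothBridge.ins () places.φ₀)) 1))
      Complex.I 0 ∧ Complex.I ≠ 0 := by
  refine ⟨(smoothBridge.toScalarBridge.hFpt () () places.φ₀ () 1).congr_deriv ?_, Complex.I_ne_zero⟩
  show pointed.evalPt () (core.TΦc (smoothBridge.ins () (smoothBridge.XR () places.φ₀)) 1) = Complex.I
  rw [smooth_limit_eq_I, evalPt_apply, TΦc_apply, mul_one]

/-- The chart's joint eigenvector predicate fires: 1 ∈ σ̂ = ⊤, R(1)1 = 1 = w(t)•1. -/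
theorem orbitCore_eigen : smoothBridge.toOrbitCore.Eigen () :=
  ⟨1, Submodule.mem_top, one_ne_zero, fun t => by
    show core.R ((1 : places.Tg →* Circle) t) 1 = (1 : places.Tg →* ℂ) t • (1 : ℂ)
    rw [MonoidHom.one_apply, MonoidHom.one_apply, one_smul, R_apply, inv_one, Circle.coe_one, one_mul]⟩

/-- **N29's conclusion fires through the circle toy's smooth bridge** on the non-vacuous premise `𝒯_1 1 = 1 ≠ 0`. -/
theorem H_occ_fires : torus.wOccurs () :=
  smoothBridge.H_occ 1 () ⟨1, Submodule.mem_top, by rw [TΦ_one_one]; exact one_ne_zero⟩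

end CircleToy

end OrbitSmoke
end ArchC
end PerL34
end HodgeCM

end
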